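import Literature.NumberTheory.EllipticCurves.FineSelmerCoefficientMapProofs
import Literature.NumberTheory.EllipticCurves.CyclotomicLocalTorsionDivisibleProofs
import Literature.NumberTheory.EllipticCurves.Kobayashi2003.FineSelmerLeSignedSelmerProofs
import Literature.NumberTheory.EllipticCurves.IwasawaSelmerProofs
import Literature.NumberTheory.EllipticCurves.HasseWeilGoodReduction
import Literature.NumberTheory.GaloisRepresentations.ContinuousH1OrderTwo
import HarnessLib

/-!
# `Sel₀(K_∞, E[p])` finite ⟹ `Sel₀(K_∞, E[p^∞])[p]` finite over the cyclotomic `ℤ_p`-extension, `p` odd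
# (Lim–Sujatha 2018, §3, proof of Prop. 3.2: the local terms; proved, no named fact)

`Proofs` file (theorems only); third brick of the discharge of
`LimSujatha2018.prop32_fineSelmerDual_moduleFinite_iff_of_torsionIso` (`FineSelmerCongruentCurves`).
With `ι = (E[p] ↪ E[p^∞])_* : H¹(K_∞, E[p]) → H¹(K_∞, E[p^∞])` (finite kernel, onto the `p`-torsion),
`Sel₀(K_∞, E[p^∞])[p] = ι(R′)` for `R′ = ι⁻¹ Sel₀(K_∞, E[p^∞]) ⊇ Sel₀(K_∞, E[p])`, and `R′ / Sel₀(K_∞, E[p])`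
embeds into the product of the LOCAL kernels `ker (H¹(K_{∞,w}, E[p]) → H¹(K_{∞,w}, E[p^∞]))` over the
places `w` of `K_∞` (Lim–Sujatha, J. Number Theory 187 (2018) §3; Greenberg LNM 1716 §3). In the
tree's all-places currency (`GreenbergSelmer.fineSelmerInfty`): §1 the local kernel vanishes where
`E(K_{∞,w})[p^∞]` is `p`-divisible — at every GOOD `w ∤ p` of the cyclotomic tower (sibling
`CyclotomicLocalTorsionDivisibleProofs`) — and, for `p` odd, at the infinite places (`H¹` of a group of
order `≤ 2` is killed by `2`, tree `ContinuousH1OrderTwo`); §2 finitely many places of `K_∞` above each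
finite `v`: `κ(D_v)` is closed and contains `κ(σ) ≠ 0`, hence `⊇ p^c ℤ_p`, so the local conditions
for ALL `σ ∈ Γ_K` follow from those at `p^c` representatives; §3 assembly
(`finite_fineSelmerInfty_pTorsion_of_finite_torsion`).

References: [LimSujatha2018] §3 (proof of Prop. 3.2); [GreenbergLNM1716] §3 (Lemmas 3.1–3.3);
[Greenberg1989] §1 p. 98; [Washington1997] §13.1; [SerreGaloisCohomology1997] I.§2.4–2.5, I.§5.1.
-/

set_option autoImplicit false

noncomputable section

open scoped Classical

universe u

namespace Literature.NumberTheory.EllipticCurves.FineSelmerCoefficientMap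

open NumberField IsDedekindDomain Field Filter Topology
open Literature.NumberTheory.EllipticCurves Literature.NumberTheory.EllipticCurves.GreenbergSelmer
  Literature.NumberTheory.GaloisRepresentations WeierstrassCurve
  Literature.NumberTheory.EllipticCurves.Greenberg1999

/-! ## §1 Local kernels of `H¹(D, E[p]) → H¹(D, E[p^∞])` -/

section LocalKernel

variable {K : Type} [Field K] (W : WeierstrassCurve K) {p : ℕ} [Fact p.Prime]

omit [Fact p.Prime] in
/-- Naturality of `(E[p] ↪ E[p^∞])_*` with restriction: `res ∘ ι = ι ∘ res`.
[cite: SerreGaloisCohomology1997, I.§2.4] -/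
theorem resOfLe_torsionToPrimaryH1Sub {H₁ H₂ : Subgroup (absoluteGaloisGroup K)} (hle : H₁ ≤ H₂)
    (y : subgroupH1 H₂ (W.geomTorsion (p : ℤ))) :
    resOfLe (W.geomPrimaryTorsion p) hle (W.torsionToPrimaryH1Sub p H₂ y) =
      W.torsionToPrimaryH1Sub p H₁ (resOfLe (↥(W.geomTorsion (p : ℤ))) hle y) := by
  unfold WeierstrassCurve.torsionToPrimaryH1Sub
  exact congrArg (fun f : subgroupH1 H₂ (W.geomTorsion (p : ℤ)) →+ W.subgroupH1 p H₁ ↦ f y)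
    (resOfLe_comp_resH1Hom_id hle
      (AddSubgroup.inclusion (WeierstrassCurve.geomTorsion_le_geomPrimaryTorsion W p))
      (fun _ _ ↦ rfl) (fun _ _ ↦ rfl))

omit [Fact p.Prime] in
/-- **Vanishing of the local kernel from `p`-divisibility of the fixed points.** Let `D ≤ Γ_K` and
suppose every `D`-fixed point of `E[p^∞]` is `p` times a `D`-fixed point. Then
`H¹(D, E[p]) → H¹(D, E[p^∞])` is injective: a cocycle `φ` with `ι ∘ φ = ∂t` has `p t` fixed by `D`,
so `p t = p b` with `b` fixed, and `φ = ∂(t - b)` with `t - b ∈ E[p]` (the Kummer sequence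
`E(L)[p^∞]/p ↪ H¹(L, E[p]) → H¹(L, E[p^∞])[p]`, Greenberg LNM 1716 §3 proof of Lemma 3.1).
[cite: GreenbergLNM1716, §3 (proof of Lemma 3.1)] [cite: LimSujatha2018, §3 (proof of Prop. 3.2)] -/
theorem eq_zero_of_torsionToPrimaryH1Sub_eq_zero_of_divisible (D : Subgroup (absoluteGaloisGroup K))
    (hdiv : ∀ a : W.geomPrimaryTorsion p, (∀ g : D, (g : absoluteGaloisGroup K) • a = a) →
      ∃ b : W.geomPrimaryTorsion p, (∀ g : D, (g : absoluteGaloisGroup K) • b = b) ∧ p • b = a)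
    (y : subgroupH1 D (W.geomTorsion (p : ℤ))) (hy : W.torsionToPrimaryH1Sub p D y = 0) : y = 0 := by
  obtain ⟨φ, rfl⟩ := oneCocycleClass_surjective _ y
  rw [WeierstrassCurve.torsionToPrimaryH1Sub_oneCocycleClass, oneCocycleClass_eq_zero_iff] at hy
  obtain ⟨t, ht⟩ := hy
  have ht' : ∀ g : D, ((φ.1 g : W.geomTorsion (p : ℤ)) : W.geomPoints) =
      (((g : absoluteGaloisGroup K) • t - t : W.geomPrimaryTorsion p) : W.geomPoints) := fun g ↦
    congrArg (fun z : W.geomPrimaryTorsion p ↦ (z : W.geomPoints)) (ht g)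
  -- `a = p t` is `D`-fixed
  have ha : ∀ g : D, (g : absoluteGaloisGroup K) • (p • t) = p • t := by
    intro g
    apply Subtype.ext
    have h1 := ht' g
    rw [AddSubgroupClass.coe_sub, primaryComponent.coe_smul] at h1
    have h2 : (p : ℤ) • ((φ.1 g : W.geomTorsion (p : ℤ)) : W.geomPoints) = 0 := (φ.1 g).2
    rw [h1, smul_sub, sub_eq_zero, natCast_zsmul] at h2
    rw [primaryComponent.coe_smul, AddSubgroupClass.coe_nsmul, smul_comm, h2, natCast_zsmul]
  obtain ⟨b, hb, hpb⟩ := hdiv (p • t) ha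
  -- `s = t - b ∈ E[p]`
  have hs : (p : ℤ) • ((t : W.geomPoints) - b) = 0 := by
    rw [smul_sub, natCast_zsmul, natCast_zsmul, ← AddSubgroupClass.coe_nsmul,
      ← AddSubgroupClass.coe_nsmul, hpb, sub_self]
  rw [oneCocycleClass_eq_zero_iff]
  refine ⟨⟨(t : W.geomPoints) - b, hs⟩, fun g ↦ Subtype.ext ?_⟩
  change ((φ.1 g : W.geomTorsion (p : ℤ)) : W.geomPoints) =
    ((((g : absoluteGaloisGroup K) • (⟨(t : W.geomPoints) - b, hs⟩ : W.geomTorsion (p : ℤ)) -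
      ⟨(t : W.geomPoints) - b, hs⟩ : W.geomTorsion (p : ℤ))) : W.geomPoints)
  rw [ht' g, AddSubgroupClass.coe_sub, primaryComponent.coe_smul, AddSubgroupClass.coe_sub,
    AddSubgroup.torsionBy.coe_smul]
  have hb' : (g : absoluteGaloisGroup K) • (b : W.geomPoints) = b := by
    have := congrArg (fun z : W.geomPrimaryTorsion p ↦ (z : W.geomPoints)) (hb g)
    rwa [primaryComponent.coe_smul] at this
  change (g : absoluteGaloisGroup K) • (t : W.geomPoints) - t =
    (g : absoluteGaloisGroup K) • ((t : W.geomPoints) - b) - ((t : W.geomPoints) - b)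
  rw [smul_sub, hb']
  abel

variable [NumberField K] (κ : ZpExtension K p)

/-- **At a good place `v ∤ p` of the cyclotomic `ℤ_p`-extension the local kernel vanishes**: for
`y ∈ H¹(Gal(K̄/K_∞) ⊓ D_v, E[p])`, `ι y = 0 ⟹ y = 0` (`E(K_{∞,w})[p^∞]` is `p`-divisible,
`ZpExtension.IsCyclotomic.exists_fixed_and_nsmul_eq_of_hasGoodReductionAt`). [cite: GreenbergLNM1716, §3 Lemma 3.3 (proof, p. 87)] [cite: LimSujatha2018, §3 (proof of Prop. 3.2)] -/
theorem eq_zero_of_torsionToPrimaryH1Sub_eq_zero_of_hasGoodReductionAt [W.IsElliptic]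
    (hκ : κ.IsCyclotomic) {v : HeightOneSpectrum (𝓞 K)} (hpv : (p : 𝓞 K) ∉ v.asIdeal)
    (hv : W.HasGoodReductionAt v) (y : subgroupH1 (κ.kerSubgroup ⊓ decomp v) (W.geomTorsion (p : ℤ)))
    (hy : W.torsionToPrimaryH1Sub p (κ.kerSubgroup ⊓ decomp v) y = 0) : y = 0 := by
  refine eq_zero_of_torsionToPrimaryH1Sub_eq_zero_of_divisible W _ (fun a ha ↦ ?_) y hy
  obtain ⟨b, hb, hpb⟩ := ZpExtension.IsCyclotomic.exists_fixed_and_nsmul_eq_of_hasGoodReductionAt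
    W hκ hpv hv (a := a) (fun δ hδ ↦ ha ⟨δ, hδ⟩)
  exact ⟨b, fun g ↦ hb g g.2, hpb⟩

omit [Fact p.Prime] [NumberField K] in
/-- **At an infinite place, for `p` odd, `H¹(Gal(K̄/K_∞) ⊓ D_w, E[p]) = 0`**: the group has order `≤ 2`
(`natCard_absoluteGaloisGroup_completion_infinitePlace_le_two`) and the classes are killed by the odd
number `p` (tree `eq_zero_of_odd_nsmul_eq_zero_of_natCard_le_two`, Serre I §2.4 Cor. of Prop. 9).
[cite: SerreGaloisCohomology1997, I §2.4 (Cor. of Prop. 9)] -/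
theorem subgroupH1_geomTorsion_inf_decompInf_eq_zero (hp : Odd p) (H : Subgroup (absoluteGaloisGroup K))
    (w : InfinitePlace K) (y : subgroupH1 (H ⊓ decompInf w) (W.geomTorsion (p : ℤ))) : y = 0 := by
  haveI := finite_absoluteGaloisGroup_completion_infinitePlace w
  -- `H ⊓ D_w` embeds in the image of `Γ_{K_w}`, of order `≤ 2`
  have hsurj : ∀ g : (H ⊓ decompInf w : Subgroup (absoluteGaloisGroup K)),
      ∃ τ : absoluteGaloisGroup w.Completion, absGaloisRestrict K w.Completion τ = g := fun g ↦
    (Subgroup.mem_inf.mp g.2).2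
  choose lift hlift using hsurj
  have hinj : Function.Injective lift := fun g g' h ↦ by
    apply Subtype.ext
    rw [← hlift g, ← hlift g', h]
  haveI : Finite (H ⊓ decompInf w : Subgroup (absoluteGaloisGroup K)) := Finite.of_injective lift hinj
  have hcard : Nat.card (H ⊓ decompInf w : Subgroup (absoluteGaloisGroup K)) ≤ 2 :=
    (Nat.card_le_card_of_injective lift hinj).trans
      (natCard_absoluteGaloisGroup_completion_infinitePlace_le_two w)
  exact eq_zero_of_odd_nsmul_eq_zero_of_natCard_le_two hcard _ hp y
    (p_smul_subgroupH1_geomTorsion_eq_zero W _ y)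

end LocalKernel

/-! ## §2 Finitely many places of `K_∞` above `v`: representatives for the local conditions -/

section Reps

variable {p : ℕ} [Fact p.Prime]

/-- A closed additive subgroup of `ℤ_p` containing `u ≠ 0` contains `p^{v(u)} ℤ_p`: it contains
`ℤ u`, which is dense in `ℤ_p u = p^{v(u)} ℤ_p`. (The closed subgroups of `ℤ_p` are `0` and the
`p^n ℤ_p`.) [cite: Washington1997, §13.1] -/
theorem pow_valuation_mul_mem_of_isClosed (Z : AddSubgroup ℤ_[p]) (hZ : IsClosed (Z : Set ℤ_[p]))
    {u : ℤ_[p]} (hu : u ∈ Z) (hu0 : u ≠ 0) (z : ℤ_[p]) :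
    (p : ℤ_[p]) ^ u.valuation * z ∈ Z := by
  have hS : ∀ y : ℤ_[p], u * y ∈ Z := by
    have hclosed : IsClosed {y : ℤ_[p] | u * y ∈ Z} :=
      hZ.preimage (continuous_const.mul continuous_id)
    have hsub : Set.range (Int.cast : ℤ → ℤ_[p]) ⊆ {y : ℤ_[p] | u * y ∈ Z} := by
      rintro _ ⟨n, rfl⟩
      change u * (n : ℤ_[p]) ∈ Z
      rw [mul_comm, ← zsmul_eq_mul]
      exact Z.zsmul_mem hu n
    have hdense : Dense {y : ℤ_[p] | u * y ∈ Z} := PadicInt.denseRange_intCast.mono hsub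
    have huniv : {y : ℤ_[p] | u * y ∈ Z} = Set.univ := by
      rw [← hclosed.closure_eq, hdense.closure_eq]
    intro y
    have : y ∈ {y : ℤ_[p] | u * y ∈ Z} := by rw [huniv]; exact Set.mem_univ y
    exact this
  obtain ⟨w, hw⟩ : ∃ w : ℤ_[p]ˣ, u = (w : ℤ_[p]) * (p : ℤ_[p]) ^ u.valuation :=
    ⟨_, PadicInt.unitCoeff_spec hu0⟩
  have h := hS (((w⁻¹ : ℤ_[p]ˣ) : ℤ_[p]) * z)
  have key : u * (((w⁻¹ : ℤ_[p]ˣ) : ℤ_[p]) * z) = (p : ℤ_[p]) ^ u.valuation * z := by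
    calc u * (((w⁻¹ : ℤ_[p]ˣ) : ℤ_[p]) * z)
        = ((w : ℤ_[p]) * ((w⁻¹ : ℤ_[p]ˣ) : ℤ_[p])) * ((p : ℤ_[p]) ^ u.valuation * z) := by
          nth_rewrite 1 [hw]; ring
      _ = (p : ℤ_[p]) ^ u.valuation * z := by rw [Units.mul_inv, one_mul]
  rwa [key] at h

variable {K : Type} [Field K] [NumberField K] {κ : ZpExtension K p}

omit [NumberField K] in
/-- `res_{H ⊓ D} ∘ conj_δ` vanishes on a class as soon as `res_{H ⊓ D}` does, for `δ ∈ D`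
(`D` normalises `H ⊓ D`; on cocycles `conj_δ φ = δ • φ(δ⁻¹ · δ)` is principal on `H ⊓ D` with
`δ • t` when `φ` is with `t`). [cite: SerreGaloisCohomology1997, I.§2.5 and I.§5.1] -/
theorem resOfLe_conjH1_eq_zero_of_mem {M : Type} [AddCommGroup M]
    [DistribMulAction (absoluteGaloisGroup K) M] [TopologicalSpace M] [DiscreteTopology M]
    (H : Subgroup (absoluteGaloisGroup K)) [H.Normal] (D : Subgroup (absoluteGaloisGroup K))
    {δ : absoluteGaloisGroup K} (hδ : δ ∈ D) {x : subgroupH1 H M}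
    (hx : resOfLe M (inf_le_left : H ⊓ D ≤ H) x = 0) :
    resOfLe M (inf_le_left : H ⊓ D ≤ H) (conjH1 H M δ x) = 0 := by
  obtain ⟨φ, rfl⟩ := oneCocycleClass_surjective _ x
  rw [resOfLe, resH1Hom_oneCocycleClass, oneCocycleClass_eq_zero_iff] at hx
  obtain ⟨t, ht⟩ := hx
  rw [conjH1_oneCocycleClass, resOfLe, resH1Hom_oneCocycleClass, oneCocycleClass_eq_zero_iff]
  refine ⟨δ • t, fun g ↦ ?_⟩
  have hg := Subgroup.mem_inf.mp g.2
  have hg' : δ⁻¹ * (g : absoluteGaloisGroup K) * δ ∈ H ⊓ D :=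
    Subgroup.mem_inf.mpr ⟨conj_mem_of_normal H δ ⟨g, hg.1⟩,
      D.mul_mem (D.mul_mem (D.inv_mem hδ) hg.2) hδ⟩
  -- the value of `φ` at `δ⁻¹ g δ`
  have h1 := ht ⟨δ⁻¹ * (g : absoluteGaloisGroup K) * δ, hg'⟩
  rw [pullback_resHomOfEquivariant_apply, AddMonoidHom.id_apply] at h1
  have h1' : φ.1 (subgroupInclusion (inf_le_left : H ⊓ D ≤ H)
      ⟨δ⁻¹ * (g : absoluteGaloisGroup K) * δ, hg'⟩) =
      (δ⁻¹ * (g : absoluteGaloisGroup K) * δ) • t - t := h1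
  -- the value of the conjugated, restricted cocycle at `g`
  rw [pullback_resHomOfEquivariant_apply, AddMonoidHom.id_apply, conjCocycle_apply]
  have h2 : subgroupConj H δ (subgroupInclusion (inf_le_left : H ⊓ D ≤ H) g) =
      subgroupInclusion (inf_le_left : H ⊓ D ≤ H) ⟨δ⁻¹ * (g : absoluteGaloisGroup K) * δ, hg'⟩ :=
    Subtype.ext (by rw [subgroupConj_apply_coe]; rfl)
  rw [h2, h1', smul_sub, smul_smul, ← mul_assoc, ← mul_assoc, mul_inv_cancel, one_mul, mul_smul]
  rfl

/-- **Representatives for the places of `K_∞` above a finite place `v`** (cyclotomic `κ`): there is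
`c` such that, for any choice `τ i` of elements with `κ(τ i) = i` (`i < p^c`), the local conditions
"`res_{H ⊓ D_v} (conj_σ x) = 0`" for ALL `σ ∈ Γ_K` follow from those for `σ = τ i`, `i < p^c`:
`κ(D_v)` is closed and contains `κ(σ_v) ≠ 1` (`exists_apply_resGal_ne_one_of_isCyclotomic`), hence
`⊇ p^c ℤ_p`, so every `σ` is `δ · τ i · h` with `δ ∈ D_v`, `h ∈ H = ker κ` (`conj_h = id`,
`resOfLe_conjH1_eq_zero_of_mem`). "Only finitely many primes of `F^cyc` lie above each prime of `S`."
[cite: LimSujatha2018, §3 (proof of Prop. 3.2)] [cite: GreenbergLNM1716, §1 ("v is finitely decomposed in F_∞/F")] -/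
theorem forall_resOfLe_conjH1_eq_zero_of_reps {M : Type} [AddCommGroup M]
    [DistribMulAction (absoluteGaloisGroup K) M] [TopologicalSpace M] [DiscreteTopology M]
    (hκ : κ.IsCyclotomic) (v : HeightOneSpectrum (𝓞 K)) :
    ∃ c : ℕ, ∀ (τ : ℕ → absoluteGaloisGroup K),
      (∀ i, κ (τ i) = Multiplicative.ofAdd ((i : ℕ) : ℤ_[p])) →
      ∀ x : subgroupH1 κ.kerSubgroup M,
        (∀ i, i < p ^ c → resOfLe M (inf_le_left : κ.kerSubgroup ⊓ decomp v ≤ κ.kerSubgroup)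
          (conjH1 κ.kerSubgroup M (τ i) x) = 0) →
        ∀ σ : absoluteGaloisGroup K, resOfLe M (inf_le_left : κ.kerSubgroup ⊓ decomp v ≤ κ.kerSubgroup)
          (conjH1 κ.kerSubgroup M σ x) = 0 := by
  -- the closed subgroup `κ(D_v)` and a non-zero element `u` in it
  obtain ⟨σv, hσv⟩ := exists_apply_resGal_ne_one_of_isCyclotomic hκ v
  set u : ℤ_[p] := (κ (resGal (K := K) (v.adicCompletion K) σv)).toAdd with hudef
  have hu0 : u ≠ 0 := fun h ↦ hσv (Multiplicative.toAdd.injective h)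
  let Z : AddSubgroup ℤ_[p] :=
    AddSubgroup.toSubgroup.symm ((decomp v).map (κ.toContinuousMonoidHom : absoluteGaloisGroup K →* Multiplicative ℤ_[p]))
  have hZmem : ∀ y : ℤ_[p], y ∈ Z ↔ ∃ δ ∈ decomp v, κ δ = Multiplicative.ofAdd y := fun y ↦ by
    change Multiplicative.ofAdd y ∈ (decomp v).map _ ↔ _
    rw [Subgroup.mem_map]
    rfl
  have hZclosed : IsClosed (Z : Set ℤ_[p]) := by
    have hc : IsCompact (((decomp v).map
        (κ.toContinuousMonoidHom : absoluteGaloisGroup K →* Multiplicative ℤ_[p]) :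
        Subgroup (Multiplicative ℤ_[p])) : Set (Multiplicative ℤ_[p])) := by
      rw [Subgroup.coe_map]
      exact (Kobayashi2003.isCompact_decomp v).image κ.toContinuousMonoidHom.continuous
    exact hc.isClosed
  have huZ : u ∈ Z := (hZmem u).mpr ⟨_, (mem_decomp_iff v _).mpr ⟨σv, rfl⟩, rfl⟩
  refine ⟨u.valuation, fun τ hτ x hx σ ↦ ?_⟩
  set c := u.valuation with hc
  -- write `κ σ = i + p^c z`, `i < p^c`
  set y : ℤ_[p] := (κ σ).toAdd with hy
  set i : ℕ := (PadicInt.toZModPow c y).val with hi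
  have hi_lt : i < p ^ c := ZMod.val_lt _
  have hyi : y - i ∈ Ideal.span {(p : ℤ_[p]) ^ c} := by
    rw [← PadicInt.ker_toZModPow, RingHom.mem_ker, map_sub, map_natCast, hi, ZMod.natCast_zmod_val,
      sub_self]
  obtain ⟨z, hz⟩ := Ideal.mem_span_singleton.mp hyi
  -- `p^c z ∈ κ(D_v)`: `y - i = κ δ`
  obtain ⟨δ, hδD, hδ⟩ := (hZmem _).mp (hz ▸ pow_valuation_mul_mem_of_isClosed Z hZclosed huZ hu0 z :
    y - i ∈ Z)
  -- `h = (δ τ_i)⁻¹ σ ∈ ker κ`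
  have hh : (δ * τ i)⁻¹ * σ ∈ κ.kerSubgroup := by
    rw [ZpExtension.mem_kerSubgroup, map_mul, map_inv, map_mul, hδ, hτ i]
    apply Multiplicative.toAdd.injective
    rw [toAdd_mul, toAdd_inv, toAdd_mul, toAdd_ofAdd, toAdd_ofAdd, toAdd_one, ← hy]
    ring
  have hσ : σ = δ * (τ i * ((δ * τ i)⁻¹ * σ)) := by group
  rw [hσ, conjH1_mul_holds, AddMonoidHom.comp_apply, conjH1_mul_holds, AddMonoidHom.comp_apply,
    conjH1_of_mem_holds κ.kerSubgroup M hh, AddMonoidHom.id_apply]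
  exact resOfLe_conjH1_eq_zero_of_mem κ.kerSubgroup (decomp v) hδD (hx i hi_lt)

end Reps

/-! ## §3 Assembly -/

section Assembly

variable {K : Type} [Field K] [NumberField K] (W : WeierstrassCurve K) [W.IsElliptic] {p : ℕ}
  [Fact p.Prime] (κ : ZpExtension K p)

/-- **`Sel₀(K_∞, E[p])` finite ⟹ `Sel₀(K_∞, E[p^∞])[p]` finite** for the cyclotomic `ℤ_p`-extension of a
number field `K`, an elliptic curve `E = W/K` and an odd prime `p`. Proof: see the module docstring
(`R′ = ι⁻¹ Sel₀(K_∞, E[p^∞])` has finite image in `∏_{v ∈ S, i < p^c} ker ι_{H ⊓ D_v}` — `S` the bad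
places and the places above `p` — with kernel `Sel₀(K_∞, E[p])`: the conditions at `v ∈ S` for all
`σ` follow from the representatives, at good `v ∤ p` and at infinite places the local kernels vanish).
The hard half of Lim–Sujatha's "`R(A[π]/F^cyc)` finite ⟺ `Y(A/F^cyc)` finitely generated over `𝒪`".
[cite: LimSujatha2018, §3 (proof of Prop. 3.2)] [cite: GreenbergLNM1716, §3 (Lemmas 3.1–3.3)] -/
theorem finite_fineSelmerInfty_pTorsion_of_finite_torsion (hκ : κ.IsCyclotomic) (hp : p ≠ 2)
    (hfin : (fineSelmerInfty (↥(W.geomTorsion (p : ℤ))) κ :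
      Set (subgroupH1 κ.kerSubgroup (W.geomTorsion (p : ℤ)))).Finite) :
    Set.Finite {s : W.fineSelmerInfty κ | p • s = 0} := by
  have hpr : p.Prime := Fact.out
  have hpodd : Odd p := hpr.odd_of_ne_two hp
  -- notation
  let H := κ.kerSubgroup
  let Mp : Type := ↥(W.geomTorsion (p : ℤ))
  let ι : subgroupH1 H Mp →+ W.subgroupH1 p H := W.torsionToPrimaryH1Sub p H
  -- the finite set `S` of bad places and places above `p`
  have hSfin : ({v : HeightOneSpectrum (𝓞 K) | (p : 𝓞 K) ∈ v.asIdeal} ∪ W.badPlaces (𝓞 K)).Finite := by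
    refine Set.Finite.union ?_ (W.finite_badPlaces_holds (𝓞 K))
    have hne : Ideal.span {(p : 𝓞 K)} ≠ 0 := by
      rw [Ideal.zero_eq_bot, Ne, Ideal.span_singleton_eq_bot]
      exact_mod_cast hpr.ne_zero
    refine (Ideal.finite_factors hne).subset fun v hv ↦ ?_
    simp only [Set.mem_setOf_eq] at hv ⊢
    exact Ideal.dvd_iff_le.mpr ((Ideal.span_singleton_le_iff_mem _).mpr hv)
  set S := hSfin.toFinset with hSdef
  have hS : ∀ v ∉ S, (p : 𝓞 K) ∉ v.asIdeal ∧ W.HasGoodReductionAt v := by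
    intro v hv
    rw [hSdef, Set.Finite.mem_toFinset, Set.mem_union, not_or] at hv
    refine ⟨hv.1, ?_⟩
    by_contra h
    exact hv.2 h
  -- representatives: a uniform `c` and the elements `τ i`
  have hreps := fun v : HeightOneSpectrum (𝓞 K) ↦
    forall_resOfLe_conjH1_eq_zero_of_reps (M := Mp) hκ v
  choose cv hcv using hreps
  let c : ℕ := S.sup cv
  have hτex : ∀ i : ℕ, ∃ τ : absoluteGaloisGroup K, κ τ = Multiplicative.ofAdd ((i : ℕ) : ℤ_[p]) :=
    fun i ↦ κ.surjective _
  choose τ hτ using hτex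
  -- the signature map `Ψ`
  let resv : ∀ v : HeightOneSpectrum (𝓞 K), subgroupH1 H Mp →+ subgroupH1 (H ⊓ decomp v) Mp := fun v ↦
    resOfLe Mp (inf_le_left : H ⊓ decomp v ≤ H)
  let Ψ : subgroupH1 H Mp →+ ((v : S) → Fin (p ^ c) → subgroupH1 (H ⊓ decomp (v : HeightOneSpectrum (𝓞 K))) Mp) :=
    { toFun := fun x v i ↦ resv v (conjH1 H Mp (τ i) x)
      map_zero' := by ext v i; simp
      map_add' := fun x y ↦ by ext v i; simp }
  -- `R′ = ι⁻¹ Sel₀(K_∞, E[p^∞])`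
  let R' : AddSubgroup (subgroupH1 H Mp) := (W.fineSelmerInfty κ).comap ι
  have hR'mem : ∀ x : subgroupH1 H Mp, x ∈ R' ↔ ι x ∈ W.fineSelmerInfty κ := fun x ↦ Iff.rfl
  -- (a) values of `Ψ` on `R′` lie in the finite local kernels
  have hΨker : ∀ x ∈ R', ∀ (v : S) (i : Fin (p ^ c)),
      Ψ x v i ∈ (W.torsionToPrimaryH1Sub p (H ⊓ decomp (v : HeightOneSpectrum (𝓞 K)))).ker := by
    intro x hx v i
    rw [AddMonoidHom.mem_ker]
    change W.torsionToPrimaryH1Sub p _ (resv v (conjH1 H Mp (τ i) x)) = 0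
    rw [← resOfLe_torsionToPrimaryH1Sub, ← WeierstrassCurve.conjH1_torsionToPrimaryH1Sub]
    exact ((mem_fineSelmerInfty_iff_resOfLe κ _).mp ((hR'mem x).mp hx)).1 v (τ i)
  -- (b) the kernel of `Ψ` on `R′` is contained in `Sel₀(K_∞, E[p])`
  have hΨzero : ∀ x ∈ R', Ψ x = 0 → x ∈ fineSelmerInfty Mp κ := by
    intro x hx hΨ
    have hxS : ι x ∈ W.fineSelmerInfty κ := (hR'mem x).mp hx
    have hxS' := (mem_fineSelmerInfty_iff_resOfLe κ _).mp hxS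
    rw [mem_fineSelmerInfty_iff_resOfLe]
    refine ⟨fun v σ ↦ ?_, fun w σ ↦ ?_⟩
    · by_cases hvS : v ∈ S
      · -- representatives
        refine hcv v τ hτ x (fun i hi ↦ ?_) σ
        have hi' : i < p ^ c := lt_of_lt_of_le hi (Nat.pow_le_pow_right hpr.pos (Finset.le_sup hvS))
        have := congrFun (congrFun hΨ ⟨v, hvS⟩) ⟨i, hi'⟩
        exact this
      · -- good place `v ∤ p`: the local kernel vanishes
        obtain ⟨hpv, hgood⟩ := hS v hvS
        refine eq_zero_of_torsionToPrimaryH1Sub_eq_zero_of_hasGoodReductionAt W κ hκ hpv hgood _ ?_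
        rw [← resOfLe_torsionToPrimaryH1Sub, ← WeierstrassCurve.conjH1_torsionToPrimaryH1Sub]
        exact hxS'.1 v σ
    · exact subgroupH1_geomTorsion_inf_decompInf_eq_zero W hpodd H w _
  -- (c) `R′` is finite
  have hR'fin : (R' : Set (subgroupH1 H Mp)).Finite := by
    -- restrict `Ψ` to `R′`
    let g : R' →+ ((v : S) → Fin (p ^ c) → subgroupH1 (H ⊓ decomp (v : HeightOneSpectrum (𝓞 K))) Mp) :=
      Ψ.comp R'.subtype
    have hgker : ((g.ker : AddSubgroup R') : Set R').Finite := by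
      have hsub : ((g.ker : AddSubgroup R') : Set R') ⊆
          (fun r : R' ↦ (r : subgroupH1 H Mp)) ⁻¹' (fineSelmerInfty Mp κ : Set (subgroupH1 H Mp)) := by
        intro r hr
        exact hΨzero r r.2 ((AddMonoidHom.mem_ker).mp hr)
      exact (hfin.preimage Subtype.val_injective.injOn).subset hsub
    let T : Set ((v : S) → Fin (p ^ c) → subgroupH1 (H ⊓ decomp (v : HeightOneSpectrum (𝓞 K))) Mp) :=
      Set.pi Set.univ fun v ↦ Set.pi Set.univ fun _ ↦
        ((W.torsionToPrimaryH1Sub p (H ⊓ decomp (v : HeightOneSpectrum (𝓞 K)))).ker : Set _)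
    have hTfin : T.Finite := by
      refine Set.Finite.pi fun v ↦ Set.Finite.pi fun _ ↦ ?_
      exact W.finite_ker_torsionToPrimaryH1Sub p (H := H ⊓ decomp (v : HeightOneSpectrum (𝓞 K)))
        W.zsmul_geomPoints_surjective_holds
    have huniv : (g ⁻¹' T) = Set.univ := by
      ext r
      simp only [Set.mem_preimage, Set.mem_univ, iff_true, T, Set.mem_univ_pi]
      intro v i
      exact hΨker r r.2 v i
    have hR'univ : (Set.univ : Set R').Finite := by
      rw [← huniv]
      exact AddMonoidHom.finite_preimage_of_finite_ker g hgker hTfin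
    have : (R' : Set (subgroupH1 H Mp)) = (fun r : R' ↦ (r : subgroupH1 H Mp)) '' Set.univ := by
      ext x
      simp only [SetLike.mem_coe, Set.image_univ, Set.mem_range, Subtype.exists, exists_prop,
        exists_eq_right]
    rw [this]
    exact hR'univ.image _
  -- (d) every `p`-torsion class of `Sel₀(K_∞, E[p^∞])` is `ι x` with `x ∈ R′`
  have hsub : {s : W.fineSelmerInfty κ | p • s = 0} ⊆
      (fun s : W.fineSelmerInfty κ ↦ (s : W.subgroupH1 p H)) ⁻¹' (ι '' (R' : Set (subgroupH1 H Mp))) := by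
    intro s hs
    have hs' : p • (s : W.subgroupH1 p H) = 0 := by
      rw [← AddSubgroupClass.coe_nsmul, show p • s = 0 from hs]; rfl
    obtain ⟨x, hx⟩ := W.exists_torsionToPrimaryH1Sub_eq p W.zsmul_geomPoints_surjective_holds hs'
    refine ⟨x, ?_, hx⟩
    change ι x ∈ W.fineSelmerInfty κ
    rw [show ι x = (s : W.subgroupH1 p H) from hx]
    exact s.2
  exact ((hR'fin.image ι).preimage Subtype.val_injective.injOn).subset hsub

end Assembly

end Literature.NumberTheory.EllipticCurves.FineSelmerCoefficientMap

end
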